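import Literature.NumberTheory.Transcendental.DiazLadderOfProp411
import Literature.NumberTheory.Transcendental.NesterenkoEliminationProp411Holds
import HarnessLib

/-!
# Diaz 1989, Corollaire 2 (`diaz_1989`), discharged

`Literature/NumberTheory/Transcendental/DiazLadderHolds.lean` — proofs-only sibling of
`DiazLadder.lean`. The named fact `diaz_1989` (G. Diaz, J. Number Theory 31 (1989), Cor. 2 =
LNM 1752 Ch. 14 Cor. 2.8: `trdeg_ℚ ℚ(α^β, …, α^{β^{d−1}}) ≥ ⌊(d+1)/2⌋`) was reduced in
`DiazLadderOfProp411.lean` to the single named fact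
`Nesterenko.NesterenkoPhilippon2001_ch3_prop_4_11` (LNM 1752 Ch. 3 Prop. 4.11, the metric Bézout
inequality), which is now a theorem of the tree
(`Nesterenko.NesterenkoPhilippon2001_ch3_prop_4_11_holds`, `NesterenkoEliminationProp411Holds.lean`).
This file records the discharge `diaz_1989_holds`. No definitions, no named facts.

## References

* [Diaz1989] G. Diaz, *Grands degrés de transcendance pour des familles d'exponentielles*,
  J. Number Theory 31 (1989), 1–23, Corollaire 2.
* [NesterenkoPhilippon2001] Yu. V. Nesterenko, P. Philippon (eds.), *Introduction to Algebraic
  Independence Theory*, LNM 1752, Springer 2001, Ch. 14 Cor. 2.8 (p. 249); Ch. 3 §4 Prop. 4.11.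
-/

namespace Literature.NumberTheory.Transcendental

/-- **Diaz 1989, Corollaire 2, proved**: for `α` algebraic, `l = log α ≠ 0`, `β` algebraic of
degree `d ≥ 2`, `trdeg_ℚ ℚ(α^β, …, α^{β^{d−1}}) ≥ ⌊(d+1)/2⌋` — `diaz_1989_of_prop_4_11`
(Philippon's criterion run on Nesterenko's invariants, Diaz's Théorème 1 and zero lemma, LNM 1752
Ch. 3 Props. 4.4, 4.13) applied to the discharged Prop. 4.11
`Nesterenko.NesterenkoPhilippon2001_ch3_prop_4_11_holds`.
[cite: Diaz1989, Cor. 2] [cite: NesterenkoPhilippon2001, Ch. 14 Cor. 2.8 (p. 249)] -/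
theorem diaz_1989_holds : diaz_1989 :=
  diaz_1989_of_prop_4_11 Nesterenko.NesterenkoPhilippon2001_ch3_prop_4_11_holds

end Literature.NumberTheory.Transcendental
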